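import Literature.Computability.AlgebraicComplexity.MignonRessayreBound
import Summits.ValiantsHypothesis.ValiantsHypothesis.Theorems.SymPencilHessianRankSymmDet

/-!
# Route SymPencil — `SdcPerSqPred` (item stmt-ValiantsHypothesis-5678):
# every symmetric affine determinantal representation of `per_n`, `n ≥ 3`, has size `≥ n² − 1`

The solid rung of the symmetric Mignon–Ressayre argument.  Two tree facts are combined:

* the symmetric rank bound (item `HessianRankSymmDet`, landed in
  `Theorems/SymPencilHessianRankSymmDet.lean` as
  `Summit.ValiantsHypothesis.Theorems.rank_hessianMatrix_le_card_add_one_of_isAffineDetRepr_of_isSymm`):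
  if `f = det A` with `A` a SYMMETRIC `m × m` matrix of affine linear forms over a field and
  `f(x) = 0`, then `rank Hess f (x) ≤ m + 1` (versus `2m` without symmetry, Mignon–Ressayre 2004);
* the Mignon–Ressayre point `y₀` of the permanental hypersurface
  (`Literature/Computability/AlgebraicComplexity/MignonRessayreBound.lean`): `per_n(y₀) = 0`
  (`eval_mrPoint_perPoly`) and `Hess per_n (y₀) = (n-3)! • mrHess` (`hess0_transl_mrPoint_perPoly`,
  read through `hess0_transl`), of full rank `n²` (`rank_mrHess`, characteristic `0`).

Hence `n² = rank Hess per_n (y₀) ≤ m + 1` for every symmetric affine determinantal representation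
of `per_n` of size `m`, `n ≥ 3` (`sdcPerSqPred_proof`, the route decl verbatim) — double the
record `dc(per_n) ≥ n²/2` of the non-symmetric model, one short of the crux `SdcPerSq` (`n² ≤ m`).

References: Mignon–Ressayre 2004, Thm. 1.1 and §§2–3; Landsberg 2017, §6.4.6 (the point `y₀`,
Lemma 6.4.6.3); Grenet–Kaltofen–Koiran–Portier 2011, §1.1 (symmetric representations).
-/

noncomputable section

-- single-conjunct layout: Sub = Summit, duplicated namespace component intended
set_option linter.dupNamespace false

namespace Summit.ValiantsHypothesis.ValiantsHypothesis.Theorems.SymPencilSdcPerSqPred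

open Literature.Computability.AlgebraicComplexity MvPolynomial Matrix

/-- **The Hessian of the permanent at the Mignon–Ressayre point**, in the `hessianMatrix`
vocabulary of `HessianRank.lean`: `Hess per_{m+3} (y₀) = m! • mrHess` (the tree states this for
`hess0 ∘ transl y₀`, `hess0_transl_mrPoint_perPoly`; the two Hessians agree entrywise by
`hess0_transl`). -/
theorem hessianMatrix_perPoly_mrPoint (k : Type*) [CommRing k] (m : ℕ) :
    hessianMatrix (perPoly (Fin (m + 3)) k) (mrPoint k m) = (m.factorial : k) • mrHess k m := by
  rw [← hess0_transl_mrPoint_perPoly]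
  ext s t
  rw [hessianMatrix_apply, hess0_transl]

/-- Over a field of characteristic `0` the Hessian of `per_{m+3}` at the Mignon–Ressayre point has
full rank `(m+3)²` (`rank_mrHess`, Landsberg 2017 Lemma 6.4.6.3, and `m! ≠ 0`). -/
theorem rank_hessianMatrix_perPoly_mrPoint (k : Type*) [Field k] [CharZero k] (m : ℕ) :
    (hessianMatrix (perPoly (Fin (m + 3)) k) (mrPoint k m)).rank = (m + 3) ^ 2 := by
  rw [hessianMatrix_perPoly_mrPoint, rank_smul_eq (by exact_mod_cast Nat.factorial_ne_zero m),
    rank_mrHess]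

/-- **`SdcPerSqPred` (item stmt-ValiantsHypothesis-5678).** For `n ≥ 3`, every symmetric affine
determinantal representation of `per_n` over `ℂ` has size `m` with `n² ≤ m + 1`: at the
Mignon–Ressayre zero `y₀` of `per_n` (`eval_mrPoint_perPoly`) the Hessian of the permanent has rank
`n²` (`rank_hessianMatrix_perPoly_mrPoint`), while the symmetric rank bound
`rank_hessianMatrix_le_card_add_one_of_isAffineDetRepr_of_isSymm` (item `HessianRankSymmDet`) gives
rank `≤ m + 1`. -/
theorem sdcPerSqPred_proof :
    Summit.ValiantsHypothesis.ValiantsHypothesis.Theses.SymPencil.SdcPerSqPred := by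
  intro n hn m A hAs hA
  obtain ⟨m', rfl⟩ : ∃ m', n = m' + 3 := ⟨n - 3, by omega⟩
  have hrank := Summit.ValiantsHypothesis.Theorems.rank_hessianMatrix_le_card_add_one_of_isAffineDetRepr_of_isSymm
    hAs hA (mrPoint ℂ m') eval_mrPoint_perPoly
  rwa [rank_hessianMatrix_perPoly_mrPoint, Fintype.card_fin] at hrank

end Summit.ValiantsHypothesis.ValiantsHypothesis.Theorems.SymPencilSdcPerSqPred

end
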